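import Mathlib
import HarnessLib
import Summits.ValiantsHypothesis.ValiantsHypothesis.Theses.MonotoneRestoration
import Literature.Computability.AlgebraicComplexity.SymmetricCircuitSubstitution
import Literature.Computability.AlgebraicComplexity.SymmetricCircuitGradientSymmetry
import Literature.Computability.AlgebraicComplexity.SymmetricDetCircuitEval
import Summits.ValiantsHypothesis.ValiantsHypothesis.Theorems.MonotoneRestorationMonotoneRestorationQPZetaMatrix
import Summits.ValiantsHypothesis.ValiantsHypothesis.Theorems.MonotoneRestorationMonotoneRestorationQPZetaHomogeneous
import Summits.ValiantsHypothesis.ValiantsHypothesis.Theorems.MonotoneRestorationMonotoneRestorationQPPderivDetPoly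

/-! # Route MonotoneRestoration — crux `MonotoneRestorationQP`, line Sketch v10: THEOREM ζ-A
(stmt-ValiantsHypothesis-15886, lead c5)

**Adjugates of equivariant matrix circuits restore with polynomial symmetric size.**
Part of THEOREM ζ (the SIZE CALCULUS of Dawar–Wilsenach square-symmetric circuits): the GRADIENT
of Le Verrier's symmetric determinant circuit (Z7, `IsSymmetric.exists_gradient`, p162405; Le
Verrier = Dawar–Wilsenach Thm 4.1, `leVerrierCircuit`) is an equivariant circuit for the cofactor
matrix of the generic matrix (Z13, `stub_pderiv_detPoly`, p163852: `∂ det X/∂ x_ij = adj X_ji`);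
transposing (ζ-M0) and substituting an equivariant matrix circuit `M` into it (Z1) gives `adj M`.

* `zeta_symmetric_adjugate_generic` — `adj X` for the variable matrix, on `((n+2)⁴+1)²(n²+1)+2`
  gates;
* `zeta_symmetric_adjugate` — `adj M` for an equivariant matrix circuit `M` on `|G|` gates:
  `|G| + ((n+2)⁴+1)²(n²+1)+2` gates;
* `qpSymmetric_adjugate` — COROLLARY AT THE CRUX'S SCALE (registered): adjugates of
  quasi-polynomial-size equivariant matrix circuits over `ℂ` are quasi-polynomial-size equivariant
  matrix circuits. With ζ-M (`det`) this is the inverse `M⁻¹ = adj M / det M` up to the (invariant,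
  symmetrically computed) scalar `det M`: equivariant LINEAR ALGEBRA never leaves the conclusion
  class of the crux.
-/

noncomputable section

-- `Summit.ValiantsHypothesis.ValiantsHypothesis.…` is the tree's mandated namespace (Sub = Summit).
set_option linter.dupNamespace false

namespace Summit.ValiantsHypothesis.ValiantsHypothesis.Theorems

open Literature.Computability.AlgebraicComplexity

/-- **ζ-A1 — the adjugate of the generic matrix** is computed, as an equivariant family indexed
by `Fin n × Fin n`, by a square-symmetric circuit on at most `((n+2)⁴+1)²(n²+1)+2` gates
(characteristic `0`): the gradient of Le Verrier's determinant circuit, transposed. [folklore] -/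
theorem zeta_symmetric_adjugate_generic (K : Type) [Field K] [CharZero K] (n : ℕ)
    [MulAction (Equiv.Perm (Fin n)) Unit] :
    ∃ (G : Type) (_ : Fintype G) (C : LabelledArithCircuit K (Fin n × Fin n) (Fin n × Fin n) G),
      C.IsSymmetric (Equiv.Perm (Fin n)) ∧
      (∀ i j, C.eval (C.output (i, j)) = (Matrix.mvPolynomialX (Fin n) (Fin n) K).adjugate i j) ∧
      Fintype.card G ≤ ((n + 2) ^ 4 + 1) ^ 2 * (n * n + 1) + 2 := by
  obtain ⟨G₂, i₂, C₂, h₂, hev₂, hc₂⟩ := exists_isSymmetric_circuit_detPoly K n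
  obtain ⟨Gg, ig, Cg, hg, hevg, hcg⟩ := h₂.exists_gradient
  obtain ⟨Ct, ht, hevt⟩ := zeta_symmetric_transpose Cg hg
  refine ⟨Gg, ig, Ct, ht, fun i j => ?_, hcg.trans ?_⟩
  · rw [hevt, hevg, hev₂, stub_pderiv_detPoly]
  · have hX : Fintype.card (Fin n × Fin n) = n * n := by simp
    rw [hX]
    have h1 : Fintype.card G₂ + 1 ≤ (n + 2) ^ 4 + 1 := by omega
    exact Nat.add_le_add_right (Nat.mul_le_mul_right _ (Nat.pow_le_pow_left h1 2)) 2

/-- **ζ-A2 — ADJUGATES OF EQUIVARIANT MATRIX CIRCUITS.** Over a field of characteristic `0`: if an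
equivariant matrix `M` is computed by a square-symmetric circuit on `|G|` gates, then `adj M` is
computed, as an equivariant family indexed by `Fin n × Fin n`, by a square-symmetric circuit on at
most `|G| + ((n+2)⁴+1)²(n²+1)+2` gates (ζ-A1 substituted after `M`, Z1). [folklore] -/
theorem zeta_symmetric_adjugate {K X G : Type} [Field K] [CharZero K] {n : ℕ}
    [MulAction (Equiv.Perm (Fin n)) X] [MulAction (Equiv.Perm (Fin n)) Unit] [Fintype G]
    (C : LabelledArithCircuit K X (Fin n × Fin n) G) (hC : C.IsSymmetric (Equiv.Perm (Fin n))) :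
    ∃ (G' : Type) (_ : Fintype G') (C' : LabelledArithCircuit K X (Fin n × Fin n) G'),
      C'.IsSymmetric (Equiv.Perm (Fin n)) ∧
      (∀ i j, C'.eval (C'.output (i, j)) =
        (Matrix.of fun i j => C.eval (C.output (i, j))).adjugate i j) ∧
      Fintype.card G' ≤ Fintype.card G + (((n + 2) ^ 4 + 1) ^ 2 * (n * n + 1) + 2) := by
  obtain ⟨G₂, i₂, C₂, h₂, hev₂, hc₂⟩ := zeta_symmetric_adjugate_generic K n
  obtain ⟨G', i', C', h', hev', hc'⟩ := hC.exists_substitution h₂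
  refine ⟨G', i', C', h', fun i j => ?_, hc'.trans (Nat.add_le_add_left hc₂ _)⟩
  rw [hev' (i, j), hev₂]
  set f : MvPolynomial (Fin n × Fin n) K →ₐ[K] MvPolynomial X K :=
    MvPolynomial.aeval fun x' => C.eval (C.output x') with hf
  have h := congrFun (congrFun (AlgHom.map_adjugate f (Matrix.mvPolynomialX (Fin n) (Fin n) K)) i) j
  rw [AlgHom.mapMatrix_apply, Matrix.map_apply] at h
  have hM : f.mapMatrix (Matrix.mvPolynomialX (Fin n) (Fin n) K) =
      Matrix.of fun i j => C.eval (C.output (i, j)) := by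
    ext a b
    simp [hf, Matrix.mvPolynomialX, AlgHom.mapMatrix_apply]
  rw [h, hM]

/-- Quasi-polynomial bookkeeping for ζ-A. [folklore] -/
theorem zeta_qp_adjugate_le (c : ℕ) : ∃ c' : ℕ, ∀ n : ℕ,
    2 ^ ((Nat.log 2 n + c) ^ c) + (((n + 2) ^ 4 + 1) ^ 2 * (n * n + 1) + 2) ≤
      2 ^ ((Nat.log 2 n + c') ^ c') := by
  obtain ⟨c', hc'⟩ := zeta_poly_mul_qp_le 7 10 c 1
  refine ⟨c', fun n => le_trans ?_ (hc' n)⟩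
  set Q := 2 ^ ((Nat.log 2 n + c) ^ c) with hQ
  have hQ1 : 1 ≤ Q := Nat.one_le_two_pow
  rw [one_mul]
  have h4 : (n + 2) ^ 4 + 1 ≤ 2 * (n + 2) ^ 4 := by
    have : 1 ≤ (n + 2) ^ 4 := Nat.one_le_pow _ _ (by omega)
    omega
  have hsq : ((n + 2) ^ 4 + 1) ^ 2 ≤ 4 * (n + 2) ^ 8 := by
    calc ((n + 2) ^ 4 + 1) ^ 2 ≤ (2 * (n + 2) ^ 4) ^ 2 := Nat.pow_le_pow_left h4 2
      _ = 4 * (n + 2) ^ 8 := by ring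
  have hnn : n * n + 1 ≤ (n + 2) ^ 2 := by nlinarith
  have h10 : 1 ≤ (n + 2) ^ 10 := Nat.one_le_pow _ _ (by omega)
  calc Q + (((n + 2) ^ 4 + 1) ^ 2 * (n * n + 1) + 2)
      ≤ Q + (4 * (n + 2) ^ 8 * (n + 2) ^ 2 + 2) :=
        Nat.add_le_add_left (Nat.add_le_add_right (Nat.mul_le_mul hsq hnn) 2) Q
    _ = Q + 4 * (n + 2) ^ 10 + 2 := by ring
    _ ≤ 7 * (n + 2) ^ 10 * Q := by nlinarith

/-- **THEOREM ζ-A — ADJUGATES OF EQUIVARIANT MATRIX CIRCUITS RESTORE AT QUASI-POLYNOMIAL COST.**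
If `(M_n)` is a family of equivariant `n × n` matrices over `ℂ` computed by square-symmetric
circuits (outputs `Fin n × Fin n`) of quasi-polynomial size, so is the family of adjugates
`(adj M_n)`. [folklore] -/
theorem qpSymmetric_adjugate :
    ∀ (M : (n : ℕ) → Matrix (Fin n) (Fin n) (MvPolynomial (Fin n × Fin n) ℂ)),
      (∃ c : ℕ, ∀ n : ℕ, ∃ (G : Type) (_ : Fintype G)
        (C : LabelledArithCircuit ℂ (Fin n × Fin n) (Fin n × Fin n) G),
        C.IsSymmetric (Equiv.Perm (Fin n)) ∧ (∀ i j, C.eval (C.output (i, j)) = M n i j) ∧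
          Fintype.card G ≤ 2 ^ ((Nat.log 2 n + c) ^ c)) →
      ∃ c : ℕ, ∀ n : ℕ, ∃ (G : Type) (_ : Fintype G)
        (C : LabelledArithCircuit ℂ (Fin n × Fin n) (Fin n × Fin n) G),
        C.IsSymmetric (Equiv.Perm (Fin n)) ∧
          (∀ i j, C.eval (C.output (i, j)) = (M n).adjugate i j) ∧
          Fintype.card G ≤ 2 ^ ((Nat.log 2 n + c) ^ c) := by
  intro M hM
  obtain ⟨c, hc⟩ := hM
  obtain ⟨c', hc'⟩ := zeta_qp_adjugate_le c
  refine ⟨c', fun n => ?_⟩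
  obtain ⟨G, inst, C, hsym, hev, hcard⟩ := hc n
  obtain ⟨G', i', C', h', hev', hcG⟩ := zeta_symmetric_adjugate C hsym
  refine ⟨G', i', C', h', fun i j => ?_, (hcG.trans (Nat.add_le_add_right hcard _)).trans (hc' n)⟩
  rw [hev']
  congr 1
  exact Matrix.ext fun a b => hev a b

end Summit.ValiantsHypothesis.ValiantsHypothesis.Theorems

end
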